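import Summits.QuantumAdvantage.QuantumAdvantage.Theorems.AcZeroRung.Negative.LoadBearing

/-!
# `AcZeroRung` (stmt-QuantumAdvantage-2425) — II: size bound, basis, `t`-hypothesis, fundamental filter

Sequel of `LoadBearing.lean` (same provenance: refuter work file
`Cruxes/AcZeroRung/Disproof.lean`, cycle 1). Sorry-free; nothing asserts a Theses statement.

* §3 TIGHTNESS / SIZE: every Boolean function of `n` bits has a depth-2 `acBasis` circuit of size
  `≤ 2ⁿ(n+1)+1` (`exists_depth_two_circuit`, tree toolkit `ACReal`); the sign test of `t(-d) - 2`
  gives TOTAL correlation `-∑|t-2| ≤ -#𝒟_n` (`exists_circuit_corrSum_eq_neg_sum_abs`,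
  `abs_corrSum_le`, `exists_circuit_violating`), hence `acZeroRung_false_without_size`: the
  polynomial SIZE bound carries the whole content of the crux, already at depth 2.
* §4 BASIS and HYPOTHESIS: `acZeroRung_false_without_basis` (one gate of arity `n`, depth 1,
  size 1: the proof must use that gates are `∧/∨/¬`), `acZeroRung_false_without_pins` (trivial).
* §5 FUNDAMENTAL FILTER: `acZeroRung_false_without_fund` — `t` is free off fundamental
  discriminants (`pins_iff_eqOn_fund`), so summing over all `n`-bit `d` is false (junk witness
  `junkT`).

All weakenings are instances of ONE schema `Rung H S adm` (hypothesis on `t`, family of inputs,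
admissibility of circuits) with `rung_iff : AcZeroRung ↔ Rung Pins famD acAdm`; the four
theorems are `¬ Rung Pins famD noSizeAdm`, `¬ Rung Pins famD noBasisAdm`,
`¬ Rung (fun _ => True) famD acAdm`, `¬ Rung Pins allFam acAdm`.

Sequel `LadderSets.lean`: `¬ DigitRung → ¬ AcZeroRung` and the set form of the crux.
-/

set_option linter.dupNamespace false

open scoped BigOperators Classical
open Filter Finset
open Literature.NumberTheory.QuadraticFields
open Literature.Computability.Complexity
open Literature.Probability.RandomGraphs.LowDegree (sgn sgn_true sgn_false)

noncomputable section

namespace Summit.QuantumAdvantage.QuantumAdvantage.Theorems.AcZeroRung.Negative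

-- fullbuild repair 2026-08-17: `AcZeroRung` (stmt-QuantumAdvantage-2425, dropped from the route at rev 3) is now the
-- verbatim record `Negative.AcZeroRung` of `LoadBearing.lean` (this namespace; the stale `open … (AcZeroRung DigitRung)`
-- is gone, `DigitRung` being unused here), and the deprecated alias `pins_quadFieldThreeTorsion` is spelled as the
-- Literature fact `quadFieldThreeTorsion_spec`.  No declaration below changed.

/-! ### The schema of weakenings -/

/-- SCHEMA: the rung with hypothesis `H` on the statistic `t`, family `S n` of `n`-bit inputs and
admissibility predicate `adm` on circuits (depth parameter `k`, size polynomial `p`). The crux is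
`Rung Pins famD acAdm` (`rung_iff`); each weakening below changes exactly one argument. [folklore] -/
def Rung (H : (ℤ → ℕ) → Prop) (S : ℕ → Finset ℕ)
    (adm : (n : ℕ) → Circuit (Fin n) → ℕ → Polynomial ℕ → Prop) : Prop :=
  ∀ t : ℤ → ℕ, H t → ∀ k : ℕ, ∀ p : Polynomial ℕ, ∀ ε : ℝ, 0 < ε → ∀ᶠ n : ℕ in atTop,
    ∀ C : Circuit (Fin n), adm n C k p →
      |∑ d ∈ S n, ((t (-(d:ℤ)) : ℝ) - 2) * sgn (C.eval (fun i : Fin n => Nat.testBit d i))| ≤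
        ε * ((S n).card : ℝ)

/-- The crux's admissibility: gates in `acBasis`, `acDepth ≤ k`, `size ≤ p(n)`. [folklore] -/
def acAdm (n : ℕ) (C : Circuit (Fin n)) (k : ℕ) (p : Polynomial ℕ) : Prop :=
  C.IsOver acBasis ∧ C.acDepth ≤ k ∧ C.size ≤ p.eval n

/-- Admissibility WITHOUT the size bound. [folklore] -/
def noSizeAdm (n : ℕ) (C : Circuit (Fin n)) (k : ℕ) (_p : Polynomial ℕ) : Prop :=
  C.IsOver acBasis ∧ C.acDepth ≤ k

/-- Admissibility WITHOUT the basis restriction (gates of any truth table). [folklore] -/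
def noBasisAdm (n : ℕ) (C : Circuit (Fin n)) (k : ℕ) (p : Polynomial ℕ) : Prop :=
  C.acDepth ≤ k ∧ C.size ≤ p.eval n

/-- The family of ALL `n`-bit `d` (fundamental-discriminant filter dropped). [folklore] -/
def allFam (n : ℕ) : Finset ℕ := Finset.Ico (2 ^ (n - 1) : ℕ) (2 ^ n)

/-- READ-BACK: the crux is the schema at `(Pins, famD, acAdm)`. [folklore] -/
theorem rung_iff : AcZeroRung ↔ Rung Pins famD acAdm := by
  simp only [Rung, acAdm, and_imp]
  rfl

/-! ### Depth 2 suffices without a size bound: the SIZE bound is the content -/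

/-- Two numbers `< 2ⁿ` with the same `n` low bits are equal. [folklore] -/
theorem eq_of_testBit_eq_below {n a b : ℕ} (ha : a < 2 ^ n) (hb : b < 2 ^ n)
    (h : (fun i : Fin n => Nat.testBit a i) = fun i : Fin n => Nat.testBit b i) : a = b := by
  refine Nat.eq_of_testBit_eq fun i => ?_
  by_cases hi : i < n
  · exact congrFun h ⟨i, hi⟩
  · have hm : 2 ^ n ≤ 2 ^ i := Nat.pow_le_pow_right (by norm_num) (by omega)
    rw [Nat.testBit_eq_false_of_lt (lt_of_lt_of_le ha hm),
      Nat.testBit_eq_false_of_lt (lt_of_lt_of_le hb hm)]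

/-- **Every Boolean function of `n` bits has a depth-2 circuit over `acBasis` of size
`≤ 2ⁿ(n+1)+1`** (the DNF over its satisfying assignments; tree toolkit `ACReal`). [folklore] -/
theorem exists_depth_two_circuit (n : ℕ) (f : (Fin n → Bool) → Bool) : ∃ C : Circuit (Fin n),
    C.IsOver acBasis ∧ C.acDepth ≤ 2 ∧ C.size ≤ 2 ^ n * (n + 1) + 1 ∧ ∀ x, C.eval x = f x := by
  -- literals `[x i = y i]`, depth 0, size ≤ 1
  have hlit : ∀ (y : Fin n → Bool) (i : Fin n),
      ACReal (fun x : Fin n → Bool => decide (x i = y i)) 0 1 := by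
    intro y i
    cases hy : y i
    · exact (acReal_notInput i).congr fun x => by cases x i <;> simp
    · exact ((acReal_input i).mono le_rfl zero_le_one).congr fun x => by cases x i <;> simp
  -- minterms `[x = y]`, depth 1, size ≤ n + 1
  have hmin : ∀ y : Fin n → Bool, ACReal (fun x : Fin n → Bool => decide (x = y)) 1 (n + 1) := by
    intro y
    refine ((acReal_forall_fintype (hlit y)).congr fun x => ?_).mono le_rfl (by simp)
    simp only [decide_eq_true_eq, decide_eq_decide]
    exact ⟨fun h => funext h, fun h i => congrFun h i⟩
  -- DNF over the satisfying assignments, depth 2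
  have hdnf := acReal_exists_fintype (κ := {y : Fin n → Bool // f y = true}) fun y => hmin y.1
  have hcard : Fintype.card {y : Fin n → Bool // f y = true} ≤ 2 ^ n :=
    (Fintype.card_subtype_le _).trans (by simp)
  refine ((hdnf.congr fun x => ?_).mono le_rfl (by nlinarith)).toCircuit
  simp only [decide_eq_true_eq, Subtype.exists, exists_prop, exists_eq_right']
  cases f x <;> simp

/-- The sign test `x ↦ [2 < t(-d)]` on the bits `x` of `d < 2ⁿ` (junk `false` off range). [folklore] -/
def signTest (t : ℤ → ℕ) (n : ℕ) (x : Fin n → Bool) : Bool :=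
  if h : ∃ d : ℕ, d < 2 ^ n ∧ (fun i : Fin n => Nat.testBit d i) = x then
    decide (2 < t (-(h.choose : ℤ))) else false

/-- On the bits of `d < 2ⁿ` the sign test reads `[2 < t(-d)]`. [folklore] -/
theorem signTest_testBit (t : ℤ → ℕ) {n d : ℕ} (hd : d < 2 ^ n) :
    signTest t n (fun i : Fin n => Nat.testBit d i) = decide (2 < t (-(d : ℤ))) := by
  have h : ∃ d' : ℕ, d' < 2 ^ n ∧ (fun i : Fin n => Nat.testBit d' i) = fun i : Fin n => Nat.testBit d i :=
    ⟨d, hd, rfl⟩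
  rw [signTest, dif_pos h, eq_of_testBit_eq_below h.choose_spec.1 hd h.choose_spec.2]

/-- A circuit computing the sign test has correlation sum `-∑_{𝒟_n} |t(-d) - 2|` (TOTAL). [folklore] -/
theorem corrSum_eq_neg_sum_abs_of_eval {t : ℤ → ℕ} {n : ℕ} {C : Circuit (Fin n)}
    (hev : ∀ x, C.eval x = signTest t n x) :
    corrSum t 2 n C = -∑ d ∈ famD n, |(t (-(d:ℤ)) : ℝ) - 2| := by
  rw [corrSum, ← Finset.sum_neg_distrib]
  refine Finset.sum_congr rfl fun d hd => ?_
  rw [hev, signTest_testBit t (mem_famD.mp hd).1.2]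
  by_cases h2 : 2 < t (-(d:ℤ))
  · have h2' : (2 : ℝ) < (t (-(d:ℤ)) : ℝ) := by exact_mod_cast h2
    rw [decide_eq_true h2, sgn_true, abs_of_pos (by linarith)]
    ring
  · have h2' : (t (-(d:ℤ)) : ℝ) ≤ 2 := by exact_mod_cast not_lt.mp h2
    rw [decide_eq_false h2, sgn_false, abs_of_nonpos (by linarith)]
    ring

/-- **(b) TIGHTNESS — the trivial bound is attained at depth 2.** For every `t` and every `n` there
is a depth-2 circuit over `acBasis` (size `≤ 2ⁿ(n+1)+1`) whose correlation sum is
`-∑_{𝒟_n} |t(-d) - 2|`, i.e. TOTAL. [folklore] -/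
theorem exists_circuit_corrSum_eq_neg_sum_abs (t : ℤ → ℕ) (n : ℕ) : ∃ C : Circuit (Fin n),
    C.IsOver acBasis ∧ C.acDepth ≤ 2 ∧ C.size ≤ 2 ^ n * (n + 1) + 1 ∧
      corrSum t 2 n C = -∑ d ∈ famD n, |(t (-(d:ℤ)) : ℝ) - 2| := by
  obtain ⟨C, hB, hdep, hs, hev⟩ := exists_depth_two_circuit n (signTest t n)
  exact ⟨C, hB, hdep, hs, corrSum_eq_neg_sum_abs_of_eval hev⟩

/-- The trivial bound `|corrSum| ≤ ∑ |t - 2|` for EVERY circuit (so the previous theorem is an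
equality case). [folklore] -/
theorem abs_corrSum_le (t : ℤ → ℕ) (n : ℕ) (C : Circuit (Fin n)) :
    |corrSum t 2 n C| ≤ ∑ d ∈ famD n, |(t (-(d:ℤ)) : ℝ) - 2| := by
  refine (Finset.abs_sum_le_sum_abs _ _).trans (Finset.sum_le_sum fun d _ => ?_)
  rw [abs_mul]
  cases C.eval (fun i : Fin n => Nat.testBit d i) <;> simp [sgn]

/-- For a pinned `t` the total correlation is at least `#𝒟_n` (`|3^r - 2| ≥ 1`). [folklore] -/
theorem card_le_sum_abs_sub_two {t : ℤ → ℕ} (ht : Pins t) (n : ℕ) :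
    ((famD n).card : ℝ) ≤ ∑ d ∈ famD n, |(t (-(d:ℤ)) : ℝ) - 2| := by
  calc ((famD n).card : ℝ) = ∑ d ∈ famD n, (1 : ℝ) := by simp
    _ ≤ _ := Finset.sum_le_sum fun d hd => one_le_abs_sub_two_of_pins ht hd

/-- **(a) The SIZE bound is load-bearing: without it the rung fails already at depth `k = 2`,
`ε = 1/2`, for EVERY admissible `t` and every `n ≥ 6`** (sign-test DNF). Any proof of the crux
must use `C.size ≤ p.eval n` against circuits of size `2ⁿ(n+1)+1`; the whole content is the gap
polynomial-vs-exponential size at depth 2–3. [folklore] -/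
theorem acZeroRung_false_without_size : ¬ Rung Pins famD noSizeAdm := by
  intro h
  obtain ⟨n, hn6, hn⟩ := ((eventually_ge_atTop 6).and
    (h quadFieldThreeTorsion quadFieldThreeTorsion_spec 2 0 (1 / 2) one_half_pos)).exists
  obtain ⟨C, hB, hdep, -, hsum⟩ := exists_circuit_corrSum_eq_neg_sum_abs quadFieldThreeTorsion n
  have h1 := hn C ⟨hB, hdep⟩
  change |corrSum quadFieldThreeTorsion 2 n C| ≤ _ at h1
  rw [hsum, abs_neg, abs_of_nonneg (Finset.sum_nonneg fun _ _ => abs_nonneg _)] at h1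
  have h2 := card_le_sum_abs_sub_two (t := quadFieldThreeTorsion) quadFieldThreeTorsion_spec n
  have h3 := card_famD_pos hn6
  linarith

/-- Sharper, pointwise form: for every pinned `t`, depth bound `k ≥ 2`, `ε < 1` and EVERY `n ≥ 6`
some depth-2 circuit of size `≤ 2ⁿ(n+1)+1` violates the `ε`-bound. [folklore] -/
theorem exists_circuit_violating {t : ℤ → ℕ} (ht : Pins t) {ε : ℝ} (hε : ε < 1) {n : ℕ} (hn : 6 ≤ n) :
    ∃ C : Circuit (Fin n), C.IsOver acBasis ∧ C.acDepth ≤ 2 ∧ C.size ≤ 2 ^ n * (n + 1) + 1 ∧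
      ε * ((famD n).card : ℝ) < |corrSum t 2 n C| := by
  obtain ⟨C, hB, hdep, hs, hsum⟩ := exists_circuit_corrSum_eq_neg_sum_abs t n
  refine ⟨C, hB, hdep, hs, ?_⟩
  rw [hsum, abs_neg, abs_of_nonneg (Finset.sum_nonneg fun _ _ => abs_nonneg _)]
  have h2 := card_le_sum_abs_sub_two ht n
  have h3 := card_famD_pos hn
  nlinarith

/-! ### The BASIS restriction and the `t`-hypothesis are load-bearing -/

/-- The one-gate circuit applying an arbitrary `n`-ary Boolean function to the `n` inputs (a gate
of `fullBasis`, in general NOT in `acBasis`). [folklore] -/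
def oneGate (n : ℕ) (f : (Fin n → Bool) → Bool) : Circuit (Fin n) where
  gates := [⟨n, f, fun a => Sum.inl a⟩]
  output := Sum.inr 0
  wf j h a m hm := by
    simp only [List.length_singleton, Nat.lt_one_iff] at h
    subst h
    simp at hm
  wf_output m h := by cases h; simp

/-- It computes `f`. [folklore] -/
@[simp] theorem eval_oneGate (n : ℕ) (f : (Fin n → Bool) → Bool) (x : Fin n → Bool) :
    (oneGate n f).eval x = f x := rfl

/-- It has one gate. [folklore] -/
@[simp] theorem size_oneGate (n : ℕ) (f : (Fin n → Bool) → Bool) : (oneGate n f).size = 1 := rfl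

/-- It has `acDepth ≤ 1`. [folklore] -/
theorem acDepth_oneGate_le (n : ℕ) (f : (Fin n → Bool) → Bool) : (oneGate n f).acDepth ≤ 1 := by
  show ((oneGate n f).depthVals acWeight).getD 0 0 ≤ 1
  have h1 : acWeight (⟨n, f⟩ : GateFn) ≤ 1 := by unfold acWeight; split_ifs <;> simp
  have h2 : (Finset.univ.sup fun _ : Fin n => (0 : ℕ)) ≤ 0 := Finset.sup_le fun _ _ => le_rfl
  simp only [Circuit.depthVals, oneGate, List.foldl_cons, List.foldl_nil, List.nil_append,
    List.getD_cons_zero, Gate.fn]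
  omega

/-- **(a) The basis restriction is load-bearing**: a single gate of arity `n` with the sign test
as truth table (depth 1, size 1) has total correlation. Any proof must use that the gates are
`∧/∨/¬` — i.e. a genuine AC⁰ property (switching / LMN), not just depth and size counting. [folklore] -/
theorem acZeroRung_false_without_basis : ¬ Rung Pins famD noBasisAdm := by
  intro h
  obtain ⟨n, hn6, hn⟩ := ((eventually_ge_atTop 6).and
    (h quadFieldThreeTorsion quadFieldThreeTorsion_spec 1 1 (1 / 2) one_half_pos)).exists
  have h1 := hn (oneGate n (signTest quadFieldThreeTorsion n)) ⟨acDepth_oneGate_le _ _, by simp⟩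
  change |corrSum quadFieldThreeTorsion 2 n _| ≤ _ at h1
  rw [corrSum_eq_neg_sum_abs_of_eval (eval_oneGate n _), abs_neg,
    abs_of_nonneg (Finset.sum_nonneg fun _ _ => abs_nonneg _)] at h1
  have h2 := card_le_sum_abs_sub_two (t := quadFieldThreeTorsion) quadFieldThreeTorsion_spec n
  have h3 := card_famD_pos hn6
  linarith

/-- **(a) The `t`-hypothesis is load-bearing** (trivially: `t = 0` and the constant circuit). [folklore] -/
theorem acZeroRung_false_without_pins : ¬ Rung (fun _ => True) famD acAdm := by
  intro h
  obtain ⟨n, hn6, hn⟩ :=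
    ((eventually_ge_atTop 6).and (h (fun _ => 0) trivial 1 1 1 one_pos)).exists
  obtain ⟨C, hB, hd, hs, hev⟩ := exists_const_circuit n false
  have h1 := hn C ⟨hB, hd, by simpa using hs⟩
  change |corrSum (fun _ => 0) 2 n C| ≤ _ at h1
  rw [corrSum_of_eval_const hev, sgn_false, one_mul] at h1
  simp only [Nat.cast_zero, zero_sub, Finset.sum_const, smul_neg, nsmul_eq_mul, mul_comm,
    abs_neg] at h1
  have h3 := card_famD_pos hn6
  rw [abs_of_pos (by positivity)] at h1
  linarith

/-! ### The restriction to fundamental `-d` is load-bearing (`t` is free elsewhere) -/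

/-- A pinned statistic with large junk off fundamental discriminants. [folklore] -/
def junkT (D : ℤ) : ℕ :=
  if (D % 4 = 1 ∧ Squarefree D ∧ D ≠ 1) ∨ (4 ∣ D ∧ (D / 4 % 4 = 2 ∨ D / 4 % 4 = 3) ∧ Squarefree (D / 4))
  then quadFieldThreeTorsion D else D.natAbs ^ 2 + 3

/-- `junkT` satisfies the route's hypothesis (it agrees with `#Cl₃` on fundamental `D`). [folklore] -/
theorem pins_junkT : Pins junkT :=
  (pins_iff_eqOn_fund junkT).mpr fun D hD => by rw [junkT, if_pos hD]

/-- `junkT ≥ 1` everywhere. [folklore] -/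
theorem one_le_junkT (D : ℤ) : 1 ≤ junkT D := by
  unfold junkT
  split_ifs
  · exact quadFieldThreeTorsion_pos D
  · exact le_add_self

/-- `-(2^{n-1}+1)` is not a fundamental discriminant (`≡ 3 (mod 4)`), so `junkT` takes its junk
value there. [folklore] -/
theorem junkT_neg_pow_succ {n : ℕ} (hn : 3 ≤ n) :
    junkT (-((2 ^ (n - 1) + 1 : ℕ) : ℤ)) = (2 ^ (n - 1) + 1) ^ 2 + 3 := by
  obtain ⟨m, rfl⟩ : ∃ m, n = m + 3 := ⟨n - 3, by omega⟩
  have hk : ((2 ^ (m + 3 - 1) + 1 : ℕ) : ℤ) = 4 * (2 ^ m : ℕ) + 1 := by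
    rw [show m + 3 - 1 = m + 2 by omega]; push_cast; ring
  rw [junkT, if_neg, Int.natAbs_neg, Int.natAbs_natCast]
  rw [hk]
  rintro (⟨h1, -, -⟩ | ⟨h4, -, -⟩) <;> omega

/-- **(a) The fundamental-discriminant filter is load-bearing**: with the family enlarged to all
`n`-bit `d` the rung is FALSE — the hypothesis pins `t` only on fundamental discriminants
(`pins_iff_eqOn_fund`), and the junk value at the single non-fundamental `-(2^{n-1}+1)` already
outweighs the block on the constant circuit. [folklore] -/
theorem acZeroRung_false_without_fund : ¬ Rung Pins allFam acAdm := by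
  intro h
  obtain ⟨n, hn6, hn⟩ := ((eventually_ge_atTop 6).and
    (h junkT pins_junkT 1 1 (1 / 2) one_half_pos)).exists
  obtain ⟨C, hB, hd, hs, hev⟩ := exists_const_circuit n false
  have h1 := hn C ⟨hB, hd, by simpa using hs⟩
  simp only [allFam, hev, sgn_false, mul_one] at h1
  set S := Finset.Ico (2 ^ (n - 1) : ℕ) (2 ^ n) with hS
  set d₀ : ℕ := 2 ^ (n - 1) + 1 with hd₀
  have hcardS : S.card = 2 ^ (n - 1) := by
    rw [hS, Nat.card_Ico]
    have : 2 ^ n = 2 * 2 ^ (n - 1) := by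
      rw [← pow_succ']; congr 1; omega
    omega
  have hpow6 : (32 : ℕ) ≤ 2 ^ (n - 1) :=
    calc (32 : ℕ) = 2 ^ 5 := by norm_num
      _ ≤ 2 ^ (n - 1) := Nat.pow_le_pow_right (by norm_num) (by omega)
  have hd₀S : d₀ ∈ S := by
    rw [hS, Finset.mem_Ico, hd₀]
    have : 2 ^ n = 2 * 2 ^ (n - 1) := by
      rw [← pow_succ']; congr 1; omega
    omega
  -- lower bound: the `d₀` term is huge, every other term is `≥ -1`
  have hterm : ∀ d ∈ S, (-1 : ℝ) ≤ (junkT (-(d:ℤ)) : ℝ) - 2 := by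
    intro d _
    have := one_le_junkT (-(d:ℤ))
    have : (1 : ℝ) ≤ (junkT (-(d:ℤ)) : ℝ) := by exact_mod_cast this
    linarith
  have hbig : ((2 ^ (n - 1) + 1 : ℕ) : ℝ) ^ 2 + 1 = (junkT (-(d₀:ℤ)) : ℝ) - 2 := by
    rw [hd₀, junkT_neg_pow_succ (by omega)]; push_cast; ring
  have hlow : ((2 ^ (n - 1) + 1 : ℕ) : ℝ) ^ 2 + 1 - ((S.card : ℝ) - 1) ≤
      ∑ d ∈ S, ((junkT (-(d:ℤ)) : ℝ) - 2) := by
    rw [← Finset.add_sum_erase S _ hd₀S, hbig]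
    have : -((S.card : ℝ) - 1) ≤ ∑ d ∈ S.erase d₀, ((junkT (-(d:ℤ)) : ℝ) - 2) := by
      calc -((S.card : ℝ) - 1) = ∑ d ∈ S.erase d₀, (-1 : ℝ) := by
            rw [Finset.sum_const, Finset.card_erase_of_mem hd₀S, nsmul_eq_mul, hcardS]
            push_cast [Nat.one_le_two_pow]
            ring
        _ ≤ _ := Finset.sum_le_sum fun d hd => hterm d (Finset.mem_of_mem_erase hd)
    linarith
  have h2 := (le_abs_self _).trans h1
  rw [hcardS] at hlow h2
  push_cast at hlow h2
  nlinarith [pow_pos (two_pos : (0:ℝ) < 2) (n - 1)]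

end Summit.QuantumAdvantage.QuantumAdvantage.Theorems.AcZeroRung.Negative

end
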